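import Summits.ResolutionOfSingularities.ResolutionOfSingularities.Theorems.EquisingularLiftEquisingularLiftNatCompleteIntersectionLift
import Summits.ResolutionOfSingularities.ResolutionOfSingularities.Theorems.EquisingularLiftEquisingularLiftNatDeterminantalLift
import HarnessLib

/-!
# Route `EquisingularLift`, crux EL♮ (stmt-ResolutionOfSingularities-20038) / EL♮(3) (stmt-…-20148) — named DOWNSTAIRS predicates
# of the lead's skeleton, rung v6‴ «LIFTABLE NOSE CLASS, THEN POINTS» (non-isolated branch)

res-L1-w45b-lead-2 g1 (lead). OURS; planning vocabulary of the crux chain, not a statement of any manuscript; AI-written, weaker than expert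
review. The non-isolated rungs of the EL♮ skeleton all read «blow up ℙⁿ_k along a closed `Z ⊊ ι(H)` of a NAMED LIFTABLE CLASS, then non-regular
closed points of the running reduced strict transform until regular ⇒ horizontal EL♮»; two classes are closed in the tree (smooth complete
intersections: `CILift.ciLift` p522728 / rung `stub_elnat_ciNoseThenPoints` p524326; smooth determinantal (maximal minors of a `(t+1) × t` matrix of
forms): `DetLift.detLift` p525911 / `detNoseThenPoints_closed` p527101), and the class-independent closer is `elnat_noseThenPoints_of_liftableCentre`
(p525611). This file names

* `IsLiftableCentre k n Z hZ` — the (LIFT) hypothesis of p525611 VERBATIM: for every complete DVR `O ↠ k` with algebraically closed residue field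
  there is a centre `C ⊂ ℙⁿ_O`, smooth over `O`, whose trace under every graded `φ` over `π` is `vanishingIdeal Z`;
* `IsLiftableNoseClass k n Z` — the INDUCTIVE DOWNSTAIRS CLASS generated by (ci) the data block of `CILift.ciLift` (c forms of degrees ≥ 1,
  common zero set `Z` non-empty, Jacobian-minor clause on `Z`), (det) the data block of `DetLift.detLift` (Jacobian-PAIR clause), and (union)
  DISJOINT unions — every clause DOWNSTAIRS (checkable on specimens); further classes (rational curves: res-type-032/051 `RatLift`, …) are added
  as a successor predicate, append-only;
* `IsLiftableNoseClass.isClosed`.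

The registered v6‴ stub is «∃ Z, IsLiftableNoseClass k n Z ∧ Z ⊆ ι(H) ∧ ι(H) ⊄ Z ∧ Bl_Z then points» ⇒ horizontal EL♮; it closes by p525611 once
`IsLiftableNoseClass k n Z → IsLiftableCentre k n Z _` is proved (cases ci/det: the two lift theorems; case union: res-type-051's
`liftableCentre_union` — two `O`-smooth centres with disjoint special fibres are disjoint, being proper over `O`).
-/

set_option linter.dupNamespace false

noncomputable section

open CategoryTheory AlgebraicGeometry TopologicalSpace

namespace Summit.ResolutionOfSingularities.ResolutionOfSingularities.Cruxes.EquisingularLiftNat.Sections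

/-- **(LIFT)** «the closed `Z ⊆ ℙⁿ_k` lifts to an `O`-smooth centre with exact trace over every complete DVR `O ↠ k` with algebraically closed
residue field» — the hypothesis `hLIFT` of `elnat_noseThenPoints_of_liftableCentre` (p525611) verbatim. -/
def IsLiftableCentre (k : Type) [Field k] (n : ℕ) (Z : Set (Literature.AlgebraicGeometry.Motives.projectiveSpace n k).left)
    (hZ : IsClosed Z) : Prop :=
  ∀ (O : Type) [CommRing O] [IsDomain O] [IsDiscreteValuationRing O] [IsAdicComplete (IsLocalRing.maximalIdeal O) O] [IsAlgClosed (IsLocalRing.ResidueField O)] (π : O →+* k), Function.Surjective π → (letI := MvPolynomial.gradedAlgebra (σ := Fin (n + 1)) (R := O); letI := MvPolynomial.gradedAlgebra (σ := Fin (n + 1)) (R := k); ∃ C : (AlgebraicGeometry.Proj (MvPolynomial.homogeneousSubmodule (Fin (n + 1)) O)).IdealSheafData, AlgebraicGeometry.Smooth (CategoryTheory.CategoryStruct.comp C.subschemeι (CategoryTheory.CategoryStruct.comp (AlgebraicGeometry.Proj.toSpecZero (MvPolynomial.homogeneousSubmodule (Fin (n + 1)) O)) (AlgebraicGeometry.Spec.map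 (CommRingCat.ofHom (algebraMap O ((MvPolynomial.homogeneousSubmodule (Fin (n + 1)) O) 0)))))) ∧ ∀ (φ : (MvPolynomial.homogeneousSubmodule (Fin (n + 1)) O) →+*ᵍ (MvPolynomial.homogeneousSubmodule (Fin (n + 1)) k)) (hφ' : HomogeneousIdeal.irrelevant (MvPolynomial.homogeneousSubmodule (Fin (n + 1)) k) ≤ (HomogeneousIdeal.irrelevant (MvPolynomial.homogeneousSubmodule (Fin (n + 1)) O)).map φ), (∀ s, φ s = MvPolynomial.map π s) → C.comap (AlgebraicGeometry.Proj.map φ hφ') = AlgebraicGeometry.Scheme.IdealSheafData.vanishingIdeal (⟨Z, hZ⟩ : TopologicalSpace.Closeds (Literature.AlgebraicGeometry.Motives.projectiveSpace n k).left))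

/-- **The liftable nose class** (DOWNSTAIRS, inductive): common zero sets of smooth complete-intersection data (`ci`, the data block of
`CILift.ciLift`), maximal-minor loci of smooth determinantal data (`det`, the data block of `DetLift.detLift`), and disjoint unions (`union`). -/
inductive IsLiftableNoseClass (k : Type) [Field k] (n : ℕ) :
    Set (Literature.AlgebraicGeometry.Motives.projectiveSpace n k).left → Prop
  /-- smooth complete intersections: `c` forms `f i` of degrees `d i ≥ 1`, `Z = V(f)` non-empty, Jacobian `c × c` minor clause on `Z`. -/
  | ci (c : ℕ) (f : Fin c → MvPolynomial (Fin (n + 1)) k) (d : Fin c → ℕ)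
      (h : (letI := MvPolynomial.gradedAlgebra (σ := Fin (n + 1)) (R := k); (∀ i, 1 ≤ d i ∧ f i ∈ MvPolynomial.homogeneousSubmodule (Fin (n + 1)) k (d i)) ∧ Set.Nonempty {y : (Literature.AlgebraicGeometry.Motives.projectiveSpace n k).left | ∀ i, f i ∈ (y : ProjectiveSpectrum (MvPolynomial.homogeneousSubmodule (Fin (n + 1)) k)).asHomogeneousIdeal} ∧ (∀ y ∈ {y : (Literature.AlgebraicGeometry.Motives.projectiveSpace n k).left | ∀ i, f i ∈ (y : ProjectiveSpectrum (MvPolynomial.homogeneousSubmodule (Fin (n + 1)) k)).asHomogeneousIdeal}, ∃ e : Fin c ↪ Fin (n + 1), Matrix.det (Matrix.of fun i j => MvPolynomial.pderiv (e j) (f i)) ∉ (y : ProjectiveSpectrum (MvPolynomial.homogeneousSubmodule (Fin (n + 1)) k)).asHomogeneousIdeal) ∧ IsClosed {y : (Literature.AlgebraicGeometry.Motives.projectiveSpace n k).left | ∀ i, f i ∈ (y : ProjectiveSpectrum (MvPolynomial.homogeneousSubmodule (Fin (n + 1)) k)).asHomogeneousIdeal})) :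
      IsLiftableNoseClass k n (letI := MvPolynomial.gradedAlgebra (σ := Fin (n + 1)) (R := k); {y : (Literature.AlgebraicGeometry.Motives.projectiveSpace n k).left | ∀ i, f i ∈ (y : ProjectiveSpectrum (MvPolynomial.homogeneousSubmodule (Fin (n + 1)) k)).asHomogeneousIdeal})
  /-- smooth determinantal curves/loci: a `(t+1) × t` matrix `M` of forms, `M a b ∈ 𝒜 (α a + β b)`, `Z` = locus of the maximal minors,
  Jacobian-PAIR clause on `Z` (smooth of codimension 2). -/
  | det (t : ℕ) (M : Matrix (Fin (t + 1)) (Fin t) (MvPolynomial (Fin (n + 1)) k)) (α : Fin (t + 1) → ℕ) (β : Fin t → ℕ)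
      (h : (letI := MvPolynomial.gradedAlgebra (σ := Fin (n + 1)) (R := k); (∀ a b, M a b ∈ MvPolynomial.homogeneousSubmodule (Fin (n + 1)) k (α a + β b)) ∧ (∀ y ∈ {y : (Literature.AlgebraicGeometry.Motives.projectiveSpace n k).left | ∀ l : Fin (t + 1), (M.submatrix l.succAbove id).det ∈ (y : ProjectiveSpectrum (MvPolynomial.homogeneousSubmodule (Fin (n + 1)) k)).asHomogeneousIdeal}, ∃ (a b : Fin (t + 1)) (e : Fin 2 ↪ Fin (n + 1)), Matrix.det (Matrix.of fun r s => MvPolynomial.pderiv (e s) (![(M.submatrix a.succAbove id).det, (M.submatrix b.succAbove id).det] r)) ∉ (y : ProjectiveSpectrum (MvPolynomial.homogeneousSubmodule (Fin (n + 1)) k)).asHomogeneousIdeal) ∧ IsClosed {y : (Literature.AlgebraicGeometry.Motives.projectiveSpace n k).left | ∀ l : Fin (t + 1), (M.submatrix l.succAbove id).det ∈ (y : ProjectiveSpectrum (MvPolynomial.homogeneousSubmodule (Fin (n + 1)) k)).asHomogeneousIdeal})) :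
      IsLiftableNoseClass k n (letI := MvPolynomial.gradedAlgebra (σ := Fin (n + 1)) (R := k); {y : (Literature.AlgebraicGeometry.Motives.projectiveSpace n k).left | ∀ l : Fin (t + 1), (M.submatrix l.succAbove id).det ∈ (y : ProjectiveSpectrum (MvPolynomial.homogeneousSubmodule (Fin (n + 1)) k)).asHomogeneousIdeal})
  /-- disjoint unions. -/
  | union (Z₁ Z₂ : Set (Literature.AlgebraicGeometry.Motives.projectiveSpace n k).left) :
      IsLiftableNoseClass k n Z₁ → IsLiftableNoseClass k n Z₂ → Z₁ ∩ Z₂ = ∅ → IsLiftableNoseClass k n (Z₁ ∪ Z₂)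

/-- Members of the liftable nose class are closed. -/
theorem IsLiftableNoseClass.isClosed {k : Type} [Field k] {n : ℕ}
    {Z : Set (Literature.AlgebraicGeometry.Motives.projectiveSpace n k).left} (h : IsLiftableNoseClass k n Z) : IsClosed Z := by
  induction h with
  | ci c f d h => exact h.2.2.2
  | det t M α β h => exact h.2.2
  | union Z₁ Z₂ _ _ _ ih₁ ih₂ => exact ih₁.union ih₂

end Summit.ResolutionOfSingularities.ResolutionOfSingularities.Cruxes.EquisingularLiftNat.Sections

end
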